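import Literature.NumberTheory.Rogawski1990.UnitOrbitalIntegralInertValueThetaZeroTrace       -- (this seat) the θ̄ = 0 VALUE `natCard_fixedPoints_unitaryInt_traceTorus_eq_phiZero` (contract (V2)); brings ★ `…ValueThetaZeroClosed` (setting, `phiZero`)
import Literature.NumberTheory.Rogawski1990.UnitOrbitalIntegralInertValueThetaZeroTrichotomy  -- ★ the `e = ½` sibling (CITED: nothing; kept for the reader's diff) — brings ★ `…Corner` bricks `exists_coe_eq_block_of_rel`, `exists_diagRadial`, `maximalIdeal_integer_eq_span`
import Literature.NumberTheory.Automorphic.UnitaryThreeDoubleCosetsHKTrace                    -- ★ `exists_coe_eq_flickerU_of_rel` (the 2-free level elements `u_m^{(y,z)}`)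
import Literature.NumberTheory.Automorphic.UnitaryThreeTorusBlockElementsTrace                -- ★ F1 p851889 (trace torus literal; `mem_centralizer_of_coe_eq_block` via ★ `UnitaryThreeKHFactorization`)
import Literature.NumberTheory.Automorphic.UnitaryThreeTraceTorusCornerLetters                -- ★ p852069 `v_sub_add_mul_eq_of_lt` (type A reading of `E`)
import HarnessLib

/-!
# The `θ̄ = 0` value with the frame data CONSTRUCTED, TRACE FRAME: `#Fix_{U⧸K}(t₁^{(b)}(x₁,x₂,x₃)) = φ₀(N₁, N₂, N)` from `UnramifiedLocalConjDatum` data and the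
# trichotomy alone — every residue characteristic (Flicker 1998 Prop. 14 p. 94, Prop. 6 p. 83; the 2-free twin of ★ `…ValueThetaZeroCorner` + ★ `…ValueThetaZeroTrichotomy`)

Topic `NumberTheory/Rogawski1990`; namespace `Literature.NumberTheory.Automorphic.UnitaryGroup`.  THEOREMS ONLY (no definition, no instance, no notation, no named fact,
no `sorry`); kernel lane `--supports stmt-HodgeConjecture-24833`; count-neutral.  Cell `pub/hodgecm-mathlib`, crux H413; LAYER C of the (D-UNR) in-house type-(1) programme,
block (C5)′ «VALUES» (LH3-p02 (g6) CENSUS-C5 bd72510a §6: `…ValueThetaZeroCornerTrace` = ★ Corner + ★ Trichotomy MERGED), LH4-plan (g7) WORD #46∕#50 (seat LH7-p03 (g5));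
statement of record = LH3-p02 SIGFIRST-CornerTrace 06a69e19 HEAD 1; exponent contract (V2) of WORD #50.

**`natCard_fixedPoints_unitaryInt_traceTorus_eq_phiZero_of_tri`** — for `t ∈ U(σ, Φ₃)(K)` EQUAL to the θ̄ = 0 trace literal
`t₁^{(b)}(x₁,x₂,x₃) = (x₁σb + x₃b, 0, x₁ − x₃; 0, x₂, 0; bσb(x₁ − x₃), 0, x₁b + x₃σb)` (★ F1 p851889; `b + σb = 1`, `|b| ≤ 1`, `|σb − b| = 1` (T7), `xᵢ` of norm one) over an
`UnramifiedLocalConjDatum σ ϖ` (`(2 : K) ≠ 0` the characteristic token of the block-shape lemmas), with `#𝓀 = q²`, a ring generator `a₀` (`σa₀ − a₀` a unit), exponents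
`|x₁ − x₃| = exp(−N)`, `|x₁ − x₂| = exp(−N₁)`, `|x₃ − x₂| = exp(−N₂)` and the TRICHOTOMY `(N₁ = N₂ ≤ N) ∨ (N₁ = N ≤ N₂) ∨ (N₂ = N ≤ N₁)`:
`#{x ∈ U⧸K : t·x = x} = phiZero q N₁ N₂ N` (as a rational number; `hfin` the finiteness of the fixed set).  Binders and conclusion = SIGFIRST 06a69e19 HEAD 1 VERBATIM.

PROOF = ★ Corner :60–:83 + ★ Trichotomy :80–:137 re-threaded: the frame data are CONSTRUCTED — `c = diag(1,−1,1)` (★ `exists_coe_eq_block_of_rel`), `t ∈ Z(c)`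
(★ `mem_centralizer_of_coe_eq_block` on the trace block), the 2-free level elements `u_m^{(1,−b)}` (★ `exists_coe_eq_flickerU_of_rel` at `(y,z) := (1, −b)`:
`−b − σb + 1 = 0`), the radial family in `Z(c)` (★ `exists_diagRadial`), the integer bridge at `R := 𝒪[K]` (`ι = subtype`, `σR = σ|_𝒪`, GENERATOR `gR := a₀` (T1) in place of
★'s skew unit `dR := σa₀ − a₀` and `IsUnit 2`, `ϖR := ⟨ϖ,_⟩` irreducible by ★ `maximalIdeal_integer_eq_span`) —, the exponents are DERIVED 2-freely from the trichotomy: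
with `E := (x₁ − x₂)σb + (x₃ − x₂)b = (x₁ − x₂) + (x₃ − x₁)·b` (the trace `N₊`-carrier, ★ p852069), TYPE A (`N₁ = N₂ < N`) gives `|E| = |ϖ^{N₁}|` (★ p852069
`v_sub_add_mul_eq_of_lt`: `|(x₃ − x₁)b| ≤ |ϖ^N| < |ϖ^{N₁}|`, reads `|b| ≤ 1` only), TYPE B (`N ≤ N₁, N₂`) gives `|E| ≤ |ϖ^N|` (ultrametric) — `E = 0` ALLOWED (FINDING #18's
equidistant family `(ζω, ζ, ζω⁻¹)`, `ω = b∕σb`, lies here) —, i.e. exactly the (V2) regime datum with `Np := N₁` resp. `Np := N`; then ONE call of the θ̄ = 0 VALUE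
`natCard_fixedPoints_unitaryInt_traceTorus_eq_phiZero`.  ★'s `add_sub_two_mul_ne_zero_of_normOne` (`a + c ≠ 2b`, a `|2| = 1` artefact) and `h2O : IsUnit (2 : 𝒪)` are GONE.

HONEST LABEL: HC_CM is proved only modulo the 7 printed citations (2 remaining: hLiu418 = `stmt-HodgeConjecture-24832`, h413 = `stmt-HodgeConjecture-24833`) until rung 0
closes; (D-UNR) stays PRINT by D74′; this file asserts a cell value only through the VALUE head it calls (R0∕D1 of WORD #46); pays no organ, opens no road.

## References
* [Flicker1998UnitaryFL] Y. Z. Flicker, *Elementary proof of the fundamental lemma for a unitary group*, Canad. J. Math. 50 (1998), Prop. 6 p. 83, Prop. 13 pp. 91–93, Prop. 14 p. 94, §6 p. 95.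
* [Rogawski1990] J. D. Rogawski, *Automorphic Representations of Unitary Groups in Three Variables* (1990), §4.9 Prop. 4.9.1 p. 55.
-/

set_option autoImplicit false

open scoped MatrixGroups WithZero Valued
open Matrix

namespace Literature.NumberTheory.Automorphic

namespace UnitaryGroup

open Literature.NumberTheory.Automorphic.HermitianLattice (unitaryInt mem_unitaryInt_iff UnramifiedLocalConjDatum)
open Literature.NumberTheory.Rogawski1990.Flicker1998 (phiZero)
open IsLocalRing

variable {K : Type*} [Field K] [Valued K ℤᵐ⁰] {ϖ : K} (σ : K →+* K) {J : Matrix (Fin 3) (Fin 3) K}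



section Corner

variable [IsDiscreteValuationRing 𝒪[K]] [Finite (ResidueField 𝒪[K])] [IsAdicComplete (maximalIdeal 𝒪[K]) 𝒪[K]]

set_option synthInstance.maxHeartbeats 200000 in
-- the `H`-action on `H ⧸ (K^{u_m} ∩ H)` (as in ★ (F2))
/-- **`#Fix_{U⧸K}(t₁^{(b)}(x₁,x₂,x₃)) = φ₀(N₁,N₂,N)` from the trichotomy datum, TRACE FRAME, every residue characteristic** (SIGFIRST-CornerTrace 06a69e19 HEAD 1;
twin of ★ `natCard_fixedPoints_unitaryInt_corner_eq_phiZero_of_tri` with `(hd : UnramifiedLocalConjDatum) (h2 : (2:K) ≠ 0)`, `{y}(hy)` and `{e}(h2e)` deleted, `{b}(hb)(hbv)(hbδ)` +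
norm-one `x₁ x₂ x₃` + the trace literal in their place): the frame data are CONSTRUCTED (`c = diag(1,−1,1)`, `t ∈ Z(c)`, level elements `u_m^{(1,−b)}`, radial family, the integer bridge at
`R := 𝒪[K]` with generator `a₀`), the type datum is DERIVED 2-freely from `htri` (type A: `|E| = |ϖ^{N₁}|`, `E = (x₁−x₂)σb + (x₃−x₂)b = (x₁−x₂) + (x₃−x₁)b`; type B: `|E| ≤ |ϖ^N|`,
`E = 0` allowed — FINDING #18's equidistant family), and the VALUE θ̄ = 0 head is called. [cite: Flicker1998UnitaryFL, Prop. 14 p. 94; §6 p. 95; Prop. 6 p. 83]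
[cite: Rogawski1990, §4.9 Prop. 4.9.1 p. 55] -/
theorem natCard_fixedPoints_unitaryInt_traceTorus_eq_phiZero_of_tri (hJ : J = (StdForm.antidiagonal 3).over K)
    (hd : UnramifiedLocalConjDatum σ ϖ) (h2 : (2 : K) ≠ 0)
    (hσO : ∀ y : 𝒪[K], (σ.comp 𝒪[K].subtype) y ∈ 𝒪[K])
    {q : ℕ} (hq : Nat.card (ResidueField 𝒪[K]) = q ^ 2)
    {a₀ : 𝒪[K]} (ha₀ : IsUnit (((σ.comp 𝒪[K].subtype).codRestrict 𝒪[K] hσO) a₀ - a₀))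
    {b : K} (hb : b + σ b = 1) (hbv : Valued.v b ≤ 1) (hbδ : Valued.v (σ b - b) = 1)
    {x₁ x₂ x₃ : K} (hx₁ : σ x₁ * x₁ = 1) (hx₂ : σ x₂ * x₂ = 1) (hx₃ : σ x₃ * x₃ = 1)
    {t : ↥(unitaryGroupOfForm σ J)}
    (hte : ((t : GL (Fin 3) K) : Matrix (Fin 3) (Fin 3) K) =
      !![x₁ * σ b + x₃ * b, 0, x₁ - x₃; 0, x₂, 0; b * σ b * (x₁ - x₃), 0, x₁ * b + x₃ * σ b])
    {N N₁ N₂ : ℕ} (hN : Valued.v (x₁ - x₃) = WithZero.exp (-(N : ℤ))) (hN₁ : Valued.v (x₁ - x₂) = WithZero.exp (-(N₁ : ℤ)))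
    (hN₂ : Valued.v (x₃ - x₂) = WithZero.exp (-(N₂ : ℤ)))
    (htri : (N₁ = N₂ ∧ N₁ ≤ N) ∨ (N₁ = N ∧ N₁ ≤ N₂) ∨ (N₂ = N ∧ N₂ ≤ N₁))
    (hfin : {x : ↥(unitaryGroupOfForm σ J) ⧸ unitaryInt σ J | t • x = x}.Finite) :
    (Nat.card {x : ↥(unitaryGroupOfForm σ J) ⧸ unitaryInt σ J | t • x = x} : ℚ) = phiZero q N₁ N₂ N := by
  classical
  have hϖ0 : ϖ ≠ 0 := hd.ϖ_ne_zero
  -- `c = diag(1, −1, 1)` and `t ∈ Z(c)`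
  obtain ⟨c, hc⟩ := exists_coe_eq_block_of_rel σ hJ (α := 1) (β := 0) (γ := 0) (δ := 1) (e := -1)
    (by rw [map_one, map_zero]; ring) (by rw [map_one, map_zero]; ring) (by rw [map_zero, map_one]; ring) (by rw [map_zero, map_one]; ring)
    (by rw [map_neg, map_one]; ring)
  have htH : t ∈ Subgroup.centralizer ({c} : Set ↥(unitaryGroupOfForm σ J)) := mem_centralizer_of_coe_eq_block σ hc hte
  -- the 2-free level elements `u_m^{(1,−b)}` (relation `−b + σ(−b) + 1·σ1 = 0` ⟸ `b + σb = 1`) and the radial family in `Z(c)`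
  have hz : (-b) + σ (-b) + 1 * σ 1 = 0 := by rw [map_neg, map_one]; linear_combination -hb
  have hyv : Valued.v (1 : K) = 1 := map_one _
  have hzv : Valued.v (-b) ≤ 1 := by rw [Valuation.map_neg]; exact hbv
  have hu := fun m => exists_coe_eq_flickerU_of_rel σ hJ hd hz m
  choose u hum using hu
  obtain ⟨r, hr⟩ := exists_diagRadial σ hJ hd.σϖ hϖ0 hc
  -- the integer frame at `R := 𝒪[K]` (generator `a₀`, T1)
  set σO : 𝒪[K] →+* 𝒪[K] := (σ.comp 𝒪[K].subtype).codRestrict 𝒪[K] hσO with hσOdef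
  have hσOσO : ∀ z, σO (σO z) = z := fun z => Subtype.ext (hd.σσ (z : K))
  have hιv : ∀ x : K, Valued.v x ≤ 1 ↔ x ∈ Set.range (𝒪[K].subtype) :=
    fun x => ⟨fun hx => ⟨⟨x, hx⟩, rfl⟩, by rintro ⟨z, rfl⟩; exact z.2⟩
  have hσι : ∀ z : 𝒪[K], 𝒪[K].subtype (σO z) = σ (𝒪[K].subtype z) := fun z => rfl
  have hϖle : Valued.v ϖ ≤ 1 := by rw [hd.vϖ, ← WithZero.exp_zero]; exact WithZero.exp_le_exp.2 (by norm_num)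
  have hp : Irreducible (⟨ϖ, hϖle⟩ : 𝒪[K]) := (IsDiscreteValuationRing.irreducible_iff_uniformizer _).2 (maximalIdeal_integer_eq_span hd.vϖ)
  -- the exponents in `|ϖ^n|` form
  rw [← hd.v_pow] at hN hN₁ hN₂
  have vle : ∀ {i j : ℕ}, Valued.v (ϖ ^ i) ≤ Valued.v (ϖ ^ j) ↔ j ≤ i := fun {i j} => by rw [hd.v_pow, hd.v_pow, WithZero.exp_le_exp]; omega
  have vlt : ∀ {i j : ℕ}, Valued.v (ϖ ^ i) < Valued.v (ϖ ^ j) ↔ j < i := fun {i j} => by rw [hd.v_pow, hd.v_pow, WithZero.exp_lt_exp]; omega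
  -- the trace `N₊′`-carrier `E = (x₁ − x₂)σb + (x₃ − x₂)b = (x₁ − x₂) + (x₃ − x₁)b`
  have hE : (x₁ - x₂) * σ b + (x₃ - x₂) * b = (x₁ - x₂) + (x₃ - x₁) * b := by linear_combination (x₁ - x₂) * hb
  have hσbv : Valued.v (σ b) ≤ 1 := by rw [hd.vσ]; exact hbv
  -- type B: `|E| ≤ |ϖ^N|` whenever `N ≤ N₁` and `N ≤ N₂` (ultrametric; `E = 0` allowed)
  have hB : N ≤ N₁ → N ≤ N₂ → Valued.v ((x₁ - x₂) * σ b + (x₃ - x₂) * b) ≤ Valued.v (ϖ ^ N) := fun h1 h2' => by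
    refine (Valuation.map_add _ _ _).trans (max_le ?_ ?_)
    · rw [map_mul, hN₁]
      exact (mul_le_mul' (vle.2 h1) hσbv).trans_eq (mul_one _)
    · rw [map_mul, hN₂]
      exact (mul_le_mul' (vle.2 h2') hbv).trans_eq (mul_one _)
  -- the type datum (V2)
  have h : (N₁ < N ∧ N₂ = N₁ ∧ N₁ = N₁ ∧ Valued.v ((x₁ - x₂) * σ b + (x₃ - x₂) * b) = Valued.v (ϖ ^ N₁)) ∨
      (N ≤ N₁ ∧ N ≤ N ∧ Valued.v ((x₁ - x₂) * σ b + (x₃ - x₂) * b) ≤ Valued.v (ϖ ^ N)) := by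
    rcases htri with ⟨h12, h1N⟩ | ⟨h1N, h12⟩ | ⟨h2N, h21⟩
    · rcases lt_or_eq_of_le h1N with hlt | heq
      · -- type A: `|E| = |x₁ − x₂| = |ϖ^{N₁}|` since `|(x₃ − x₁)b| ≤ |ϖ^N| < |ϖ^{N₁}|`
        refine Or.inl ⟨hlt, h12.symm, rfl, ?_⟩
        have hlt' : Valued.v ((x₃ - x₁) * b) < Valued.v (x₁ - x₂) := by
          rw [map_mul, Valuation.map_sub_swap, hN, hN₁]
          exact lt_of_le_of_lt ((mul_le_mul' le_rfl hbv).trans_eq (mul_one _)) (vlt.2 hlt)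
        rw [hE, v_sub_add_mul_eq_of_lt hlt', hN₁]
      · exact Or.inr ⟨heq.ge, le_rfl, hB heq.ge (h12 ▸ heq.ge)⟩
    · exact Or.inr ⟨h1N.ge, le_rfl, hB h1N.ge (h1N ▸ h12)⟩
    · exact Or.inr ⟨by omega, le_rfl, hB (by omega) h2N.ge⟩
  rcases h with hA | hBB
  · exact natCard_fixedPoints_unitaryInt_traceTorus_eq_phiZero σ hJ hd h2 hσO hyv hzv hz hc u hum 𝒪[K].subtype Subtype.val_injective hιv σO hσOσO hσι
      ha₀ hp rfl hq hq ha₀ hb hbv hbδ hx₁ hx₂ hx₃ hte htH r hr hN hN₁ hN₂ (Np := N₁) (Or.inl hA) hfin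
  · exact natCard_fixedPoints_unitaryInt_traceTorus_eq_phiZero σ hJ hd h2 hσO hyv hzv hz hc u hum 𝒪[K].subtype Subtype.val_injective hιv σO hσOσO hσι
      ha₀ hp rfl hq hq ha₀ hb hbv hbδ hx₁ hx₂ hx₃ hte htH r hr hN hN₁ hN₂ (Np := N) (Or.inr hBB) hfin

end Corner

end UnitaryGroup

end Literature.NumberTheory.Automorphic
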